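import Summits.BirchSwinnertonDyer.BirchSwinnertonDyer.Theorems.SignedBaseChangeAnticyclotomicEisensteinDivisibilityGreenbergFullAtSqueeze
import Summits.BirchSwinnertonDyer.BirchSwinnertonDyer.Theorems.EisensteinPrimesAcTwistDeformationCofreeRank
import HarnessLib

/-!
# Route `EisensteinPrimes` (rung K5), crux 2 `GoodLatticeBDPValue`, line `halves` v19.1, V21 index road
# input S2 (SUR_f at `v̄`) — the arena, part 3: the corank-`n` SQUEEZE (`h¹ = n`, `h² = 0` ⇒ LEO, CRK) and
# SUR(`𝐃`, `𝓛_v`) from Greenberg 2016 Prop. 2.6.3 for the one-variable twist deformation of a corank-`n`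
# `A ≃ (ℚ_p/ℤ_p)ⁿ`, with `h⁰ = 0` and LOC⁽¹⁾ as hypotheses (helper for stmt-BirchSwinnertonDyer-19032)

Cell `bsd-eis` (home `run/shared/lean/pub/bsd-eis/`), seat `bsd-line-x1-p1-w3` gen 3 (D-0154 width seat
on crux 2 `GoodLatticeBDPValue`, line `halves` v19.1). LEAD g4's V21 index road
(`Cruxes/GoodLatticeBDPValue/Lines/halves-imprimLambda-index-road.md` §3 bullet 2 / §4 S2, S4) wants on
the curve side SUR_f (and WL_f) for `𝐃_E = E[p^∞] ⊗ Λ^*(κ⁻¹)` — corank TWO. LEAD g2's `bigRep_fullAt_SUR`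
(`…AcTwistDeformationSUR`, p622277) is the corank-ONE assembly; its inputs from the published facts
(Greenberg 2006 Props. 4.1, 4.2, §5 A, 3.2 BY NAME — all typed for general corank `m`) and the seat's
corank-`n` arena (`…AcTwistDeformationCofreeRank`, p642980) give the corank-`n` assembly verbatim, except
for the two places where g2 used the SCALAR action of a character (`h⁰ = 0` globally and locally, and
LOC_v⁽¹⁾ at the places of `S`), which are taken here as HYPOTHESES (to be discharged for a non-scalar
`ρ₀` satisfying a monic quadratic — Cayley–Hamilton shape — in the next file):

* the corank-`m` SQUEEZE itself (LEO ∧ CRK ∧ `h¹ = m` ∧ `h² = 0` from Greenberg 2006 Props. 3.2/4.1/4.2/§5 A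
  by name) is cell `bsd-ssimc`'s GENERIC `SignedBaseChangeAcDivGreenbergSqueeze.leo_and_crk_fullAt_of_squeeze`
  (bsd-line-sbc-p1-w2 gen 3, written for `Ind_{K̃_∞/K} E_K[p^∞]` but generic over Greenberg's arena) —
  REUSED here, not restated;
* **`bigRep_leo_crk_pi`** (LEO ∧ CRK ∧ `h¹ = n` ∧ `h² = 0` — the WL input over `K`) and
  **`bigRep_fullAt_SUR_pi`** — SUR(`𝐃`, `𝓛_𝔭`) for `𝐃 = bigRep κ ρ₀`, `A ≃ₗ[ℤ_p] (Fin n → ℚ_p/ℤ_p)`, over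
  a `ℤ_p`-extension `κ` of an IMAGINARY QUADRATIC `K` with `p = 𝔭𝔭̄` split, GRANTED: the five published
  facts by name (h263 h41 h42 h5A h32), `corank H⁰(K_w, 𝐃) = 0` and LOC_w⁽¹⁾(𝐃) at every `w ∈ S` (the global
  `h⁰ = 0` follows from the local one at `𝔭`, `hasCorank_H0_zero_of_local`), and `corank_Λ S_{𝓛_𝔭}(K, 𝐃) = 0`
  (cofinite generation of `S_{𝓛_𝔭}` is free from Prop. 3.2).

Theorems only; conditional only through the by-name published facts; no definition, no named fact, no
`sorry`. HONEST FRAMING: closes nothing by itself (`--supports`); no summit statement / BSD / IMC2 /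
KY Thm. 1.4.1 (iii) is proved by this file. References: [Greenberg2016Selmer] Prop. 2.6.3 (§2.6 p. 10),
§2.3 p. 7, §4.3 p. 20; [Greenberg2010] Prop. 3.2.1; [Greenberg2006] Props. 3.2, 4.1, 4.2, §5 A;
[PollackWeston2011] App. A Prop. A.2 (the same surjectivity over `K_∞`, `r_v = d`).
-/

set_option autoImplicit false
set_option linter.dupNamespace false

noncomputable section

open scoped Classical
open NumberField IsDedekindDomain Field
open Literature.NumberTheory.EllipticCurves Literature.NumberTheory.GaloisRepresentations
  Literature.NumberTheory.IwasawaTheory Literature.NumberTheory.IwasawaTheory.Greenberg2016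
  Literature.NumberTheory.IwasawaTheory.Greenberg2006
  Summit.BirchSwinnertonDyer.BirchSwinnertonDyer.Theorems.TwistDeformationCofree
  Summit.BirchSwinnertonDyer.BirchSwinnertonDyer.Theorems.GreenbergFullAtSelmer
  Summit.BirchSwinnertonDyer.BirchSwinnertonDyer.Theorems.SignedBaseChangeAcDivGreenbergSqueeze

namespace Summit.BirchSwinnertonDyer.BirchSwinnertonDyer.Theorems.AcTwistDeformation

/-! ## SUR(`𝐃`, `𝓛_𝔭`), LEO, CRK and `h² = 0` for the twist deformation of a corank-`n` `A` -/

section SURRank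

variable {K : Type} [Field K] [NumberField K] {S : Set (HeightOneSpectrum (𝓞 K))} {p : ℕ} [Fact p.Prime]
  {A : Type} [AddCommGroup A] [Module ℤ_[p] A] [TopologicalSpace A] [DiscreteTopology A]
  [TopologicalSpace (PowerSeries ℤ_[p])] [IsTopologicalRing (PowerSeries ℤ_[p])]
  [IsTopologicalAddGroup (BigRepModule ℤ_[p] p A)]
  [ContinuousSMul (PowerSeries ℤ_[p]) (BigRepModule ℤ_[p] p A)]
  (hS : ∀ v : HeightOneSpectrum (𝓞 K), ((p : ℕ) : 𝓞 K) ∈ v.asIdeal → v ∈ S)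
  (κ : ZpExtension K p) (ρ₀ : ContinuousRep (GaloisGroupUnramifiedOutside K S) ℤ_[p] A) {n : ℕ}

/-- **LEO(`𝐃`) ∧ CRK(`𝐃`, `𝓛_𝔭`) ∧ `corank H¹(K_Σ/K, 𝐃) = n` ∧ `corank H²(K_Σ/K, 𝐃) = 0` for the
one-variable twist deformation `𝐃 = bigRep κ ρ₀` of `A ≃ₗ (ℚ_p/ℤ_p)ⁿ`** over a `ℤ_p`-extension of an IMAGINARY
QUADRATIC `K` with `p = 𝔭𝔭̄` split, granted Greenberg 2006 Props. 4.1, 4.2, §5 A, 3.2 by name, `h⁰ = 0` and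
LOC⁽¹⁾ at the places of `S`, and `corank_Λ S_{𝓛_𝔭}(K, 𝐃) = 0`: the corank-`n` arena (`…CofreeRank`) fed to
cell `bsd-ssimc`'s generic squeeze `leo_and_crk_fullAt_of_squeeze` (the global `h⁰ = 0` from the local one
at `𝔭`). The `h² = 0` conjunct is the weak-Leopoldt input WL of the index road (over `K`).
[cite: Greenberg2006, Props. 4.1–4.2 (§4 A pp. 367–368), §5 A, Prop. 3.2] [cite: Greenberg2016Selmer, §2.2–2.3 pp. 6–7] -/
theorem bigRep_leo_crk_pi (h41 : prop41_globalEulerPoincareCorank)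
    (h42 : prop42_localEulerPoincareCorank) (h5A : sec5A_localH2_subsingleton_of_LOC1)
    (h32 : prop32_cohomology_isCofinitelyGenerated)
    (hSf : S.Finite) (hK : IsImaginaryQuadratic K) (e : A ≃ₗ[ℤ_[p]] (Fin n → QpModZp p))
    (h0loc : ∀ v : HeightOneSpectrum (𝓞 K), v ∈ S →
      HasCorank (PowerSeries ℤ_[p])
        ((localRep S (bigRep (κ.liftUnramifiedOutside S hS) ρ₀) (Sum.inr v)).H 0) 0)
    (hLOC1fin : ∀ v : HeightOneSpectrum (𝓞 K), v ∈ S →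
      LOC1 S (bigRep (κ.liftUnramifiedOutside S hS) ρ₀) (Sum.inr v))
    {𝔭 𝔭bar : HeightOneSpectrum (𝓞 K)} (hne : 𝔭bar ≠ 𝔭)
    (hp𝔭 : ((p : ℕ) : 𝓞 K) ∈ 𝔭.asIdeal) (hp𝔭bar : ((p : ℕ) : 𝓞 K) ∈ 𝔭bar.asIdeal)
    (hSel : HasCorank (PowerSeries ℤ_[p])
      (fullAtSpecification S (bigRep (κ.liftUnramifiedOutside S hS) ρ₀) (Sum.inr 𝔭)).selmer 0) :
    LEO S (bigRep (κ.liftUnramifiedOutside S hS) ρ₀) ∧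
      (fullAtSpecification S (bigRep (κ.liftUnramifiedOutside S hS) ρ₀) (Sum.inr 𝔭)).CRK ∧
      HasCorank (PowerSeries ℤ_[p]) ((bigRep (κ.liftUnramifiedOutside S hS) ρ₀).H 1) n ∧
      HasCorank (PowerSeries ℤ_[p]) ((bigRep (κ.liftUnramifiedOutside S hS) ρ₀).H 2) 0 := by
  set ρ := bigRep (κ.liftUnramifiedOutside S hS) ρ₀ with hρ
  have hΛ := nonempty_iwasawaAlgebra_ringEquiv_mvPowerSeries p
  -- the instance data from `e`
  obtain ⟨hA, jQ, hinjQ, hsurjQ⟩ := exists_pi_character_hinj_hsurj_of_linearEquiv e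
  have hcf := isCofinitelyGenerated_bigRepModule_pi hA jQ hinjQ hsurjQ
  have hm := hasCorank_bigRepModule_pi hA jQ hinjQ hsurjQ
  have hpD : ∀ d : BigRepModule ℤ_[p] p A, ∃ n : ℕ, (p ^ n : ℤ) • d = 0 := exists_zpow_smul_eq_zero
  -- `K` imaginary quadratic, `p` split
  haveI := hK.2
  have hKc : ∀ w : InfinitePlace K, w.IsComplex := IsTotallyComplex.isComplex
  have hr₂ := nrComplexPlaces_eq_one_of_isImaginaryQuadratic hK
  have hdeg : 𝔭bar.asIdeal.ramificationIdx ℤ * 𝔭bar.asIdeal.inertiaDeg ℤ = 1 :=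
    (ncard_primesOver_eq_two_and_deg_one_of_ne hK.1 hp𝔭 hp𝔭bar hne).2 hp𝔭bar
  have hSp : ∀ v : HeightOneSpectrum (𝓞 K), v ∈ S → ((p : ℕ) : 𝓞 K) ∈ v.asIdeal →
      v = 𝔭 ∨ v = 𝔭bar := fun v _ hv ↦ eq_or_eq_of_natCast_mem_of_ne hK.1 hp𝔭 hp𝔭bar hne hv
  -- global `h⁰ = 0` from the local one at `𝔭`
  have h0 : HasCorank (PowerSeries ℤ_[p]) (ρ.H 0) 0 :=
    hasCorank_H0_zero_of_local ρ (Sum.inr 𝔭) (h32.local hSf hS hΛ ρ hpD hcf (Sum.inr 𝔭) 0)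
      (h0loc 𝔭 (hS 𝔭 hp𝔭))
  exact leo_and_crk_fullAt_of_squeeze ρ h41 h42 h32 h5A hSf hS hKc hr₂ hΛ hpD hcf hm h0 (hS 𝔭bar hp𝔭bar)
    hne hp𝔭bar hdeg hSp hLOC1fin h0loc hSel

/-- **SUR(`𝐃`, `𝓛_𝔭`) — Greenberg 2016 Prop. 2.6.3 (c) for the one-variable twist deformation
`𝐃 = bigRep κ ρ₀` of `A ≃ₗ (ℚ_p/ℤ_p)ⁿ`** (e.g. `A = E[p^∞]`, `n = 2`) over a `ℤ_p`-extension `κ` of an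
IMAGINARY QUADRATIC `K` with `p = 𝔭𝔭̄` split: the global-to-local map
`φ_{𝓛_𝔭} : H¹(K_Σ/K, 𝐃) → ∏_{w∈Σ} H¹(K_w, 𝐃)/L_w` (`L_𝔭 = ⊤`, `L_w = 0` for `w ≠ 𝔭`) IS SURJECTIVE, GRANTED
five published facts by name (Greenberg 2016 Prop. 2.6.3; Greenberg 2006 Props. 4.1, 4.2, §5 A, 3.2),
`h⁰ = 0` and LOC⁽¹⁾ at the places of `S`, and `corank_Λ S_{𝓛_𝔭}(K, 𝐃) = 0`. DISCHARGED here: `𝐃` divisible / cofree /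
corank `n` / `p`-primary (`…CofreeRank`); LEO and CRK by the squeeze (`bigRep_leo_crk_pi`); condition (c)
at `𝔭` (`Q_𝔭 = 0`).
[cite: Greenberg2016Selmer, Prop. 2.6.3 (c) (§2.6 p. 10 L13–22), §4.3 p. 20 L19–30]
[cite: Greenberg2010, Prop. 3.2.1 (p. 15)] [cite: Greenberg2006, Prop. 3.2 p. 358, Props. 4.1–4.2 (§4 A pp. 367–368), §5 A (p. 373)] -/
theorem bigRep_fullAt_SUR_pi (h263 : prop263_sur_of_crk) (h41 : prop41_globalEulerPoincareCorank)
    (h42 : prop42_localEulerPoincareCorank) (h5A : sec5A_localH2_subsingleton_of_LOC1)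
    (h32 : prop32_cohomology_isCofinitelyGenerated)
    (hSf : S.Finite) (hK : IsImaginaryQuadratic K) (e : A ≃ₗ[ℤ_[p]] (Fin n → QpModZp p))
    (h0loc : ∀ v : HeightOneSpectrum (𝓞 K), v ∈ S →
      HasCorank (PowerSeries ℤ_[p])
        ((localRep S (bigRep (κ.liftUnramifiedOutside S hS) ρ₀) (Sum.inr v)).H 0) 0)
    (hLOC1fin : ∀ v : HeightOneSpectrum (𝓞 K), v ∈ S →
      LOC1 S (bigRep (κ.liftUnramifiedOutside S hS) ρ₀) (Sum.inr v))
    {𝔭 𝔭bar : HeightOneSpectrum (𝓞 K)} (hne : 𝔭bar ≠ 𝔭)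
    (hp𝔭 : ((p : ℕ) : 𝓞 K) ∈ 𝔭.asIdeal) (hp𝔭bar : ((p : ℕ) : 𝓞 K) ∈ 𝔭bar.asIdeal)
    (hSel : HasCorank (PowerSeries ℤ_[p])
      (fullAtSpecification S (bigRep (κ.liftUnramifiedOutside S hS) ρ₀) (Sum.inr 𝔭)).selmer 0) :
    (fullAtSpecification S (bigRep (κ.liftUnramifiedOutside S hS) ρ₀) (Sum.inr 𝔭)).SUR := by
  set ρ := bigRep (κ.liftUnramifiedOutside S hS) ρ₀ with hρ
  -- standing clauses of the arena at `Λ = R = ℤ_p⟦T⟧`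
  have hΛ := nonempty_iwasawaAlgebra_ringEquiv_mvPowerSeries p
  have hcpl := isAdicComplete_maximalIdeal_iwasawaAlgebra p
  have hres := finite_residueField_iwasawaAlgebra p
  have hchar := charP_residueField_iwasawaAlgebra p
  have hinjΛ : Function.Injective (algebraMap (PowerSeries ℤ_[p]) (PowerSeries ℤ_[p])) :=
    fun a b h ↦ by simpa using h
  have hfin : Module.Finite (PowerSeries ℤ_[p]) (PowerSeries ℤ_[p]) := inferInstance
  have hlin : ∀ (g : GaloisGroupUnramifiedOutside K S) (r : PowerSeries ℤ_[p])
      (d : BigRepModule ℤ_[p] p A), ρ g (r • d) = r • ρ g d := fun g r d ↦ map_smul (ρ g) r d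
  -- the instance data from `e`
  obtain ⟨hA, jQ, hinjQ, hsurjQ⟩ := exists_pi_character_hinj_hsurj_of_linearEquiv e
  have hdiv := isDivisible_bigRepModule_pi hA jQ hinjQ hsurjQ
  have hT := isCofree_bigRepModule_pi hA jQ hinjQ hsurjQ
  have hpD : ∀ d : BigRepModule ℤ_[p] p A, ∃ n : ℕ, (p ^ n : ℤ) • d = 0 := exists_zpow_smul_eq_zero
  -- the squeeze: LEO, CRK
  obtain ⟨hLEO, hCRK, -, -⟩ := bigRep_leo_crk_pi hS κ ρ₀ h41 h42 h5A h32 hSf hK e h0loc hLOC1fin hne hp𝔭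
    hp𝔭bar hSel
  -- condition (c) at `η = 𝔭`: LOC⁽¹⁾ and `Q_𝔭 = 0` divisible
  have hQ𝔭 : IsDivisible (PowerSeries ℤ_[p]) ((fullAtSpecification S ρ (Sum.inr 𝔭)).Q (Sum.inr 𝔭)) := by
    haveI : Subsingleton ((fullAtSpecification S ρ (Sum.inr 𝔭)).Q (Sum.inr 𝔭)) :=
      Submodule.Quotient.subsingleton_iff.mpr (fullAtSpecification_self (Sum.inr 𝔭))
    exact fun θ _ s ↦ ⟨s, Subsingleton.elim _ _⟩
  -- Prop. 2.6.3 (c)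
  exact h263 p K S hSf hS (PowerSeries ℤ_[p]) 1 hΛ (PowerSeries ℤ_[p]) hinjΛ hfin hcpl hres hchar
    (BigRepModule ℤ_[p] p A) ρ hlin hT hpD (fullAtSpecification S ρ (Sum.inr 𝔭))
    (fullAtSpecification_isStable (Sum.inr 𝔭) hlin) hdiv hLEO hCRK
    (Or.inr (Or.inr ⟨𝔭, hS 𝔭 hp𝔭, hLOC1fin 𝔭 (hS 𝔭 hp𝔭), hQ𝔭⟩))

end SURRank

end Summit.BirchSwinnertonDyer.BirchSwinnertonDyer.Theorems.AcTwistDeformation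

end
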